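/-
Copyright (c) 2026 the pub-hodgecm-mathlib formalisation cell (harness21).  Prover seat hodgecm-mathlib-F0P3a-p07 (g14): «S3-ram» seeding wave (LEAD F0P3a-plan (g13);
owner F0P3a-p06 (g15)), (T2) G-side organ (Cnt2′), sub-organ (z1-d) «THE AXIS PART OF A LABELLED FIXED-LATTICE COUNT IS A W-SIDE COUNT»; 2026-09-02.
-/
import Literature.NumberTheory.Automorphic.UnitaryLatticeTreeAxisEndoFrameBasis   -- ★ p847660∕p847701 (this seat): (z1-a) + `mem_latt_endoGL_one_iff`; brings ★ (z1-b) p847645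
import Literature.NumberTheory.Automorphic.UnitaryLatticeTreeApartment            -- ★ `dualLatt_eq_self_of_isSelfDualLattice`
import HarnessLib

/-!
# The axis part of a labelled count of fixed self-dual lattices equals the corresponding count on the `W`-block (Bruhat–Tits 1972 §10; Kottwitz 1986 §3)

Topic `NumberTheory/Automorphic`; namespace `Literature.NumberTheory.Automorphic.UnitaryLatticeTree`.  THEOREMS ONLY (no definition, no instance, no notation, no named fact,
no `sorry`); kernel lane `--supports stmt-HodgeConjecture-24833`; datum-free (`K` with `Valued K ℤᵐ⁰`).  Cell `pub/hodgecm-mathlib`, crux H413; road «S3-ram» (count-neutral),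
(T2) G-side organ (Cnt2′) of F0P3a-p07 (g14)'s skeleton, sub-organ **(z1-d)** — the COUNTING form of the axis dictionary ★ (z1-a) `UnitaryLatticeTreeAxisEndoFrameBasis` + ★ (z1-b)
`UnitaryLatticeTreeAxisEndoFrame`: for the block form `H = ι-shape(H₂, h)` (`|h| = 1`, `H₂` non-degenerate), the block element `Γ = ι(γ₂, u)` (`|u| = 1`) and ANY pair of labels
`(P₃, P₂)` compatible along the frame (`P₃(latt ι(g₂,1)) ↔ P₂(latt g₂)` for all `g₂` — e.g. the (a2) tokens, by ★ (z1-b) §3 and ★ (z1-a) §3),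
**`#{M : M self-dual, Γ·M = M, e₁ ∈ M, P₃ M} = #{B : B self-dual for H₂, γ₂·B = B, P₂ B}`**, by the explicit bijection `B = latt g₂ ↦ latt ι(g₂, 1)` (well defined and injective by
★ `mem_latt_endoGL_one_iff`, onto by ★ `exists_latt_endoGL_eq_of_single_mem` — the axis condition `|x₁| ≤ 1` on a self-dual `M ∋ e₁` being `x₁·h = ⟨e₁, x⟩_H ∈ 𝒪`).  This is the
form in which the (T2) G-side count rows `stub_T2G_{zero,pm}` consume architect A-p12 (g24)'s ★ (B-i)∕(B-ii) `W`-side counts for their AXIS terms.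
ED. 2 (§3, append-only, sub-organ (z1-e)): the axis summand of EACH ROW of ★ p847724's lattice currency (`bd`, `reg`, `0`, `1±` tokens) read on the `W`-block under the (T2)
hypothesis `|u − 1| ≤ |ϖ²|`.
HONEST LABEL: HC_CM is proved only modulo the 2 remaining named inputs (hLiu418 24832, h413 24833) until rung 0 closes; elementary lattice algebra, no books consequence.

## References
* [BruhatTits1972] F. Bruhat, J. Tits, *Groupes réductifs sur un corps local I*, Publ. Math. IHÉS 41 (1972), §10.
* [Kottwitz1986] R. E. Kottwitz, *Base change for unit elements of Hecke algebras*, Compositio Math. 60 (1986), §3 (counting fixed lattices).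
* [Rogawski1990] J. D. Rogawski, *Automorphic Representations of Unitary Groups in Three Variables*, Ann. of Math. Stud. 123 (1990), §4.8 Case (a) p. 53, §4.9 p. 55.
-/

set_option autoImplicit false

noncomputable section

open scoped Valued WithZero Matrix MatrixGroups

namespace Literature.NumberTheory.Automorphic.UnitaryLatticeTree

open Literature.NumberTheory.Automorphic Literature.NumberTheory.Automorphic.HermitianLattice Literature.NumberTheory.Rogawski1990

variable {K : Type*} [Field K] [Valued K ℤᵐ⁰]

/-! ## §1 `latt ι(g₂, 1)` depends only on `latt g₂` -/

/-- `latt ι(g₂, 1) = latt ι(g₂′, 1) ⟺ latt g₂ = latt g₂′` (membership is blockwise, ★ `mem_latt_endoGL_one_iff`). [cite: BruhatTits1972, §10] -/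
theorem latt_endoGL_one_eq_iff (g₂ g₂' : GL (Fin 2) K) :
    latt ((endoGL (g₂, (1 : GL (Fin 1) K)) : GL (Fin 3) K) : Matrix (Fin 3) (Fin 3) K) = latt ((endoGL (g₂', (1 : GL (Fin 1) K)) : GL (Fin 3) K) : Matrix (Fin 3) (Fin 3) K) ↔
      latt (g₂ : Matrix (Fin 2) (Fin 2) K) = latt (g₂' : Matrix (Fin 2) (Fin 2) K) := by
  constructor
  · intro h
    ext z
    have e : (![(![z 0, 0, z 1] : Fin 3 → K) 0, (![z 0, 0, z 1] : Fin 3 → K) 2] : Fin 2 → K) = z := by ext i; fin_cases i <;> simp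
    have h0 := (mem_latt_endoGL_one_iff g₂ ![z 0, 0, z 1])
    have h1 := (mem_latt_endoGL_one_iff g₂' ![z 0, 0, z 1])
    rw [e] at h0 h1
    rw [h] at h0
    constructor
    · intro hz; exact (h1.1 (h0.2 ⟨hz, by simp⟩)).1
    · intro hz; exact (h0.1 (h1.2 ⟨hz, by simp⟩)).1
  · intro h
    ext y
    rw [mem_latt_endoGL_one_iff, mem_latt_endoGL_one_iff, h]

/-! ## §2 The axis count transport -/

/-- **THE AXIS PART OF A LABELLED FIXED-LATTICE COUNT IS THE W-SIDE COUNT.**  Block form `H = ι-shape(H₂, h)` with `det H₂ ≠ 0`, `|h| = 1`; block element `Γ = ι(γ₂, u)` with `|u| = 1`;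
labels `P₃`, `P₂` with `P₃(latt ι(g₂,1)) ↔ P₂(latt g₂)`.  Then `#{M self-dual, Γ·M = M, e₁ ∈ M, P₃ M} = #{B self-dual for H₂, γ₂·B = B, P₂ B}`.
[cite: BruhatTits1972, §10] [cite: Kottwitz1986, §3] [cite: Rogawski1990, §4.8 Case (a) p. 53] -/
theorem ncard_selfDual_fixed_axis_eq (σ : K →+* K) (hvσ : ∀ a, Valued.v (σ a) = Valued.v a) {ϖ : K} (hϖ0 : ϖ ≠ 0) (hϖ1 : Valued.v ϖ ≤ 1)
    {H₂ : Matrix (Fin 2) (Fin 2) K} (hH₂ : IsUnit H₂.det) {h : K} (hh : Valued.v h = 1) (γ₂ : GL (Fin 2) K) {u : GL (Fin 1) K} (hu : Valued.v ((u : Matrix (Fin 1) (Fin 1) K) 0 0) = 1)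
    (P₃ : Submodule 𝒪[K] (Fin 3 → K) → Prop) (P₂ : Submodule 𝒪[K] (Fin 2 → K) → Prop)
    (hP : ∀ g₂ : GL (Fin 2) K, P₃ (latt ((endoGL (g₂, (1 : GL (Fin 1) K)) : GL (Fin 3) K) : Matrix (Fin 3) (Fin 3) K)) ↔ P₂ (latt (g₂ : Matrix (Fin 2) (Fin 2) K))) :
    {M : Submodule 𝒪[K] (Fin 3 → K) | IsSelfDualLattice σ ϖ (!![H₂ 0 0, 0, H₂ 0 1; 0, h, 0; H₂ 1 0, 0, H₂ 1 1] : Matrix (Fin 3) (Fin 3) K) M ∧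
        mapGL (endoGL (γ₂, u)) M = M ∧ (Pi.single 1 1 : Fin 3 → K) ∈ M ∧ P₃ M}.ncard =
      {B : Submodule 𝒪[K] (Fin 2 → K) | IsSelfDualLattice σ ϖ H₂ B ∧ mapGL γ₂ B = B ∧ P₂ B}.ncard := by
  classical
  have hh0 : h ≠ 0 := fun h0 => by rw [h0, map_zero] at hh; exact zero_ne_one hh
  have hHdet : IsUnit (!![H₂ 0 0, 0, H₂ 0 1; 0, h, 0; H₂ 1 0, 0, H₂ 1 1] : Matrix (Fin 3) (Fin 3) K).det := by
    rw [det_endoShape]; exact hH₂.mul (isUnit_iff_ne_zero.2 hh0)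
  symm
  refine Set.ncard_congr
    (fun B hB => latt ((endoGL (Classical.choose hB.1, (1 : GL (Fin 1) K)) : GL (Fin 3) K) : Matrix (Fin 3) (Fin 3) K)) ?_ ?_ ?_
  · -- lands in the axis set
    rintro B ⟨hSD, hfix, hPB⟩
    have hg := (Classical.choose_spec hSD).1   -- `B = latt g`
    set g : GL (Fin 2) K := Classical.choose hSD with hgdef
    refine ⟨?_, ?_, ?_, ?_⟩
    · rw [isSelfDualLattice_latt_endoGL_one_iff σ hvσ hϖ0 hϖ1 H₂ hh g, ← hg]; exact hSD
    · rw [mapGL_endoGL_latt_endoGL_eq_iff, ← hg]; exact ⟨hfix, hu⟩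
    · rw [mem_latt_endoGL_one_iff]
      refine ⟨?_, by simp⟩
      have e : (![(Pi.single 1 1 : Fin 3 → K) 0, (Pi.single 1 1 : Fin 3 → K) 2] : Fin 2 → K) = 0 := by ext i; fin_cases i <;> simp
      rw [e]; exact Submodule.zero_mem _
    · rw [hP g, ← hg]; exact hPB
  · -- injective
    intro B B' hB hB' hBB
    have hg := (Classical.choose_spec hB.1).1
    have hg' := (Classical.choose_spec hB'.1).1
    exact (hg.trans ((latt_endoGL_one_eq_iff _ _).1 hBB)).trans hg'.symm
  · -- surjective
    rintro M ⟨hSD, hfix, he, hPM⟩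
    obtain ⟨g₃, hMg, -⟩ := id hSD
    -- the axis condition from self-duality: `x₁ · h = ⟨e₁, x⟩ ∈ 𝒪`
    have hax : ∀ x ∈ M, Valued.v (x 1) ≤ 1 := by
      intro x hx
      have hdual : dualLatt σ (!![H₂ 0 0, 0, H₂ 0 1; 0, h, 0; H₂ 1 0, 0, H₂ 1 1] : Matrix (Fin 3) (Fin 3) K) M = M :=
        dualLatt_eq_self_of_isSelfDualLattice hvσ hHdet hSD
      have hx' : x ∈ dualLatt σ (!![H₂ 0 0, 0, H₂ 0 1; 0, h, 0; H₂ 1 0, 0, H₂ 1 1] : Matrix (Fin 3) (Fin 3) K) M := by rw [hdual]; exact hx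
      have hp := (mem_dualLatt σ _ M x).1 hx' _ he
      rw [pairing_endoShape_apply] at hp
      have e0 : (![(Pi.single 1 1 : Fin 3 → K) 0, (Pi.single 1 1 : Fin 3 → K) 2] : Fin 2 → K) = 0 := by ext i; fin_cases i <;> simp
      rw [e0, map_zero, LinearMap.zero_apply, zero_add] at hp
      simp only [Pi.single_eq_same, map_one, one_mul] at hp
      rw [map_mul, hh, one_mul] at hp
      exact hp
    obtain ⟨g₂, hg₂⟩ := exists_latt_endoGL_eq_of_single_mem g₃ (by rw [← hMg]; exact he) (by rw [← hMg]; exact hax)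
    have hM : M = latt ((endoGL (g₂, (1 : GL (Fin 1) K)) : GL (Fin 3) K) : Matrix (Fin 3) (Fin 3) K) := hMg.trans hg₂.symm
    have hSD₂ : IsSelfDualLattice σ ϖ H₂ (latt (g₂ : Matrix (Fin 2) (Fin 2) K)) := by
      rw [← isSelfDualLattice_latt_endoGL_one_iff σ hvσ hϖ0 hϖ1 H₂ hh g₂, ← hM]; exact hSD
    have hfix₂ : mapGL γ₂ (latt (g₂ : Matrix (Fin 2) (Fin 2) K)) = latt (g₂ : Matrix (Fin 2) (Fin 2) K) := by
      have h := (mapGL_endoGL_latt_endoGL_eq_iff g₂ γ₂ u).1 (by rw [← hM]; exact hfix)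
      exact h.1
    have hP₂ : P₂ (latt (g₂ : Matrix (Fin 2) (Fin 2) K)) := by rw [← hP g₂, ← hM]; exact hPM
    refine ⟨latt (g₂ : Matrix (Fin 2) (Fin 2) K), ⟨hSD₂, hfix₂, hP₂⟩, ?_⟩
    -- the chosen frame of `latt g₂` spans the same axis lattice
    have hc := (Classical.choose_spec hSD₂).1
    rw [hM]
    exact (latt_endoGL_one_eq_iff _ _).2 hc.symm

/-! ## 3. ED. 2 — THE AXIS SUMMAND OF EACH COUNT ROW, READ ON THE `W`-BLOCK (sub-organ (z1-e))

The (T2) G-side rows of F0P3a-p05 (g17)'s ★ p847724 lattice currency (`stub_T2G_{bd,reg,zero,pm}_{even,odd}_ram_of_lattice`) count fixed self-dual `Φ₃`-lattices `M` cut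
out by the TOKENS `LEV(c) M := (Γ − 1)·M ⊆ c·M`, `LEV₂(c) M := (Γ − 1)²·M ⊆ c·M` and the rank-one CLASS token `CLS(c₀) M := ∃ y ∈ M, ∃ a, |a| = 1 ∧
|ϖ⁻¹·⟨y, (Γ − 1)y⟩ − c₀·a²| < 1`: `bd = ¬LEV(ϖ)`, `reg = LEV(ϖ) ∧ ¬LEV(ϖ²) ∧ ¬LEV₂(ϖ³)`, `0 = LEV(ϖ) ∧ LEV(ϖ²)`, `1± = LEV(ϖ) ∧ ¬LEV(ϖ²) ∧ LEV₂(ϖ³) ∧ (±)CLS(c₀)`.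
For the block element `Γ = ι(γ₂, u)` with the `u`-line 2-deep (`|u − 1| ≤ |ϖ²|`, the (T2) hypothesis) every token of an AXIS vertex `latt ι(g₂, 1)` is the same token of
its `W`-block `latt g₂` for `γ₂` (★ (z1-b) `map_endoGL_sub_one_latt_endoGL_le_scaleLattice_iff` ∕ `…_sq_…`, ★ (z1-a) ED. 2 `exists_class_latt_endoGL_one_iff`), so §2 gives,
row by row, **`#{M ∣ SD, Γ·M = M, e₁ ∈ M, TOKENS_j(Γ, M)} = #{B ∣ SD_W, γ₂·B = B, TOKENS_j(γ₂, B)}`** — the axis term of row `j` IS the `W`-side count (architect A-p12's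
★ (B-i) depth balls ∕ (B-ii) shell class law, modulo the rank-2 coset ↔ lattice dictionary ★ `ncard_fixedBy_quotient_{deep,rankOne,…}_eq_ncard_selfDual_fixed`). -/

/-- `|u − 1| ≤ |ϖ²|` and `|ϖ| < 1` give `|u| = 1`. [cite: Kottwitz1986, §3] -/
private theorem v_apply_eq_one_of_twoDeep {ϖ : K} (hϖ1 : Valued.v ϖ < 1) {u : GL (Fin 1) K}
    (hu2 : Valued.v ((u : Matrix (Fin 1) (Fin 1) K) 0 0 - 1) ≤ Valued.v (ϖ ^ 2)) : Valued.v ((u : Matrix (Fin 1) (Fin 1) K) 0 0) = 1 := by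
  have hlt : Valued.v ((u : Matrix (Fin 1) (Fin 1) K) 0 0 - 1) < 1 := by
    refine lt_of_le_of_lt hu2 ?_
    rw [map_pow]
    exact pow_lt_one₀ zero_le hϖ1 two_ne_zero
  have h := Valuation.map_one_add_of_lt Valued.v hlt
  rwa [add_sub_cancel] at h

/-- `|u − 1| ≤ |ϖ²|` and `|ϖ| < 1` give `|u − 1| ≤ |ϖ|`. [cite: Kottwitz1986, §3] -/
private theorem v_sub_one_le_of_twoDeep {ϖ : K} (hϖ1 : Valued.v ϖ < 1) {u : GL (Fin 1) K}
    (hu2 : Valued.v ((u : Matrix (Fin 1) (Fin 1) K) 0 0 - 1) ≤ Valued.v (ϖ ^ 2)) : Valued.v ((u : Matrix (Fin 1) (Fin 1) K) 0 0 - 1) ≤ Valued.v ϖ := by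
  refine hu2.trans ?_
  rw [pow_two, map_mul]
  calc Valued.v ϖ * Valued.v ϖ ≤ Valued.v ϖ * 1 := mul_le_mul' le_rfl hϖ1.le
    _ = Valued.v ϖ := mul_one _

/-- `|u − 1| ≤ |ϖ²|` and `|ϖ| < 1` give `|(u − 1)²| ≤ |ϖ³|`. [cite: Kottwitz1986, §3] -/
private theorem v_sub_one_sq_le_of_twoDeep {ϖ : K} (hϖ1 : Valued.v ϖ < 1) {u : GL (Fin 1) K}
    (hu2 : Valued.v ((u : Matrix (Fin 1) (Fin 1) K) 0 0 - 1) ≤ Valued.v (ϖ ^ 2)) :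
    Valued.v (((u : Matrix (Fin 1) (Fin 1) K) 0 0 - 1) ^ 2) ≤ Valued.v (ϖ ^ 3) := by
  rw [map_pow, map_pow]
  rw [map_pow] at hu2
  calc Valued.v ((u : Matrix (Fin 1) (Fin 1) K) 0 0 - 1) ^ 2 ≤ (Valued.v ϖ ^ 2) ^ 2 := pow_le_pow_left₀ zero_le hu2 2
    _ = Valued.v ϖ ^ 3 * Valued.v ϖ := by rw [← pow_mul, ← pow_succ]
    _ ≤ Valued.v ϖ ^ 3 * 1 := mul_le_mul' le_rfl hϖ1.le
    _ = Valued.v ϖ ^ 3 := mul_one _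

/-- `|u − 1| ≤ |ϖ²|`, `ϖ ≠ 0` and `|ϖ| < 1` give `|ϖ⁻¹·(u − 1)| < 1`. [cite: Kottwitz1986, §3] -/
private theorem v_inv_mul_sub_one_lt_one_of_twoDeep {ϖ : K} (hϖ0 : ϖ ≠ 0) (hϖ1 : Valued.v ϖ < 1) {u : GL (Fin 1) K}
    (hu2 : Valued.v ((u : Matrix (Fin 1) (Fin 1) K) 0 0 - 1) ≤ Valued.v (ϖ ^ 2)) :
    Valued.v (ϖ⁻¹ * (((u : Matrix (Fin 1) (Fin 1) K) 0 0 - 1))) < 1 := by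
  have hpos : 0 < Valued.v ϖ := (Valuation.pos_iff _).2 hϖ0
  rw [map_mul, map_inv₀]
  refine lt_of_le_of_lt ?_ hϖ1
  rw [inv_mul_le_iff₀ hpos, ← map_mul, ← pow_two]
  exact hu2

/-- **AXIS SUMMAND, ONE LEVEL TOKEN** (any scale `c ≠ 0` with `|u − 1| ≤ |c|`): `#{M ∣ SD, ι(γ₂,u)M = M, e₁ ∈ M, (ι(γ₂,u) − 1)M ⊆ cM} =
#{B ∣ SD_W, γ₂B = B, (γ₂ − 1)B ⊆ cB}`. [cite: BruhatTits1972, §10] [cite: Kottwitz1986, §3] [cite: Rogawski1990, §4.8 Case (a) p. 53] -/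
theorem ncard_selfDual_fixed_axis_lev_eq (σ : K →+* K) (hvσ : ∀ a, Valued.v (σ a) = Valued.v a) {ϖ : K} (hϖ0 : ϖ ≠ 0) (hϖ1 : Valued.v ϖ ≤ 1)
    {H₂ : Matrix (Fin 2) (Fin 2) K} (hH₂ : IsUnit H₂.det) {h : K} (hh : Valued.v h = 1) (γ₂ : GL (Fin 2) K) {u : GL (Fin 1) K}
    (hu : Valued.v ((u : Matrix (Fin 1) (Fin 1) K) 0 0) = 1) {c : K} (hc : c ≠ 0) (huc : Valued.v ((u : Matrix (Fin 1) (Fin 1) K) 0 0 - 1) ≤ Valued.v c) :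
    {M : Submodule 𝒪[K] (Fin 3 → K) | IsSelfDualLattice σ ϖ (!![H₂ 0 0, 0, H₂ 0 1; 0, h, 0; H₂ 1 0, 0, H₂ 1 1] : Matrix (Fin 3) (Fin 3) K) M ∧
        mapGL (endoGL (γ₂, u)) M = M ∧ (Pi.single 1 1 : Fin 3 → K) ∈ M ∧ M.map ((Matrix.toLin' (((endoGL (γ₂, u) : GL (Fin 3) K) : Matrix (Fin 3) (Fin 3) K) - 1)).restrictScalars 𝒪[K]) ≤ scaleLattice c M}.ncard =
      {B : Submodule 𝒪[K] (Fin 2 → K) | IsSelfDualLattice σ ϖ H₂ B ∧ mapGL γ₂ B = B ∧ B.map ((Matrix.toLin' ((γ₂ : Matrix (Fin 2) (Fin 2) K) - 1)).restrictScalars 𝒪[K]) ≤ scaleLattice c B}.ncard :=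
  ncard_selfDual_fixed_axis_eq σ hvσ hϖ0 hϖ1 hH₂ hh γ₂ hu _ _ fun g₂ => by
    rw [map_endoGL_sub_one_latt_endoGL_le_scaleLattice_iff hc]
    exact ⟨fun H => H.1, fun H => ⟨H, huc⟩⟩

/-- **AXIS SUMMAND, ROW `0`** (`u` 2-deep): `#{M ∣ SD, ΓM = M, e₁ ∈ M, LEV(ϖ) M ∧ LEV(ϖ²) M} = #{B ∣ SD_W, γ₂B = B, LEV(ϖ) B ∧ LEV(ϖ²) B}`.
[cite: BruhatTits1972, §10] [cite: Kottwitz1986, §3] [cite: Rogawski1990, §4.8 Case (a) p. 53] -/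
theorem ncard_selfDual_fixed_axis_zero_eq (σ : K →+* K) (hvσ : ∀ a, Valued.v (σ a) = Valued.v a) {ϖ : K} (hϖ0 : ϖ ≠ 0) (hϖ1 : Valued.v ϖ < 1)
    {H₂ : Matrix (Fin 2) (Fin 2) K} (hH₂ : IsUnit H₂.det) {h : K} (hh : Valued.v h = 1) (γ₂ : GL (Fin 2) K) {u : GL (Fin 1) K}
    (hu2 : Valued.v ((u : Matrix (Fin 1) (Fin 1) K) 0 0 - 1) ≤ Valued.v (ϖ ^ 2)) :
    {M : Submodule 𝒪[K] (Fin 3 → K) | IsSelfDualLattice σ ϖ (!![H₂ 0 0, 0, H₂ 0 1; 0, h, 0; H₂ 1 0, 0, H₂ 1 1] : Matrix (Fin 3) (Fin 3) K) M ∧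
        mapGL (endoGL (γ₂, u)) M = M ∧ (Pi.single 1 1 : Fin 3 → K) ∈ M ∧
        (M.map ((Matrix.toLin' (((endoGL (γ₂, u) : GL (Fin 3) K) : Matrix (Fin 3) (Fin 3) K) - 1)).restrictScalars 𝒪[K]) ≤ scaleLattice ϖ M ∧ M.map ((Matrix.toLin' (((endoGL (γ₂, u) : GL (Fin 3) K) : Matrix (Fin 3) (Fin 3) K) - 1)).restrictScalars 𝒪[K]) ≤ scaleLattice (ϖ ^ 2) M)}.ncard =
      {B : Submodule 𝒪[K] (Fin 2 → K) | IsSelfDualLattice σ ϖ H₂ B ∧ mapGL γ₂ B = B ∧ (B.map ((Matrix.toLin' ((γ₂ : Matrix (Fin 2) (Fin 2) K) - 1)).restrictScalars 𝒪[K]) ≤ scaleLattice ϖ B ∧ B.map ((Matrix.toLin' ((γ₂ : Matrix (Fin 2) (Fin 2) K) - 1)).restrictScalars 𝒪[K]) ≤ scaleLattice (ϖ ^ 2) B)}.ncard :=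
  ncard_selfDual_fixed_axis_eq σ hvσ hϖ0 hϖ1.le hH₂ hh γ₂ (v_apply_eq_one_of_twoDeep hϖ1 hu2) _ _ fun g₂ => by
    rw [map_endoGL_sub_one_latt_endoGL_le_scaleLattice_iff hϖ0, map_endoGL_sub_one_latt_endoGL_le_scaleLattice_iff (pow_ne_zero 2 hϖ0)]
    exact ⟨fun H => ⟨H.1.1, H.2.1⟩, fun H => ⟨⟨H.1, v_sub_one_le_of_twoDeep hϖ1 hu2⟩, ⟨H.2, hu2⟩⟩⟩

/-- **AXIS SUMMAND, ROW `bd`** (`u` 2-deep): `#{M ∣ SD, ΓM = M, e₁ ∈ M, ¬LEV(ϖ) M} = #{B ∣ SD_W, γ₂B = B, ¬LEV(ϖ) B}`.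
[cite: BruhatTits1972, §10] [cite: Kottwitz1986, §3] [cite: Rogawski1990, §4.8 Case (a) p. 53] -/
theorem ncard_selfDual_fixed_axis_bd_eq (σ : K →+* K) (hvσ : ∀ a, Valued.v (σ a) = Valued.v a) {ϖ : K} (hϖ0 : ϖ ≠ 0) (hϖ1 : Valued.v ϖ < 1)
    {H₂ : Matrix (Fin 2) (Fin 2) K} (hH₂ : IsUnit H₂.det) {h : K} (hh : Valued.v h = 1) (γ₂ : GL (Fin 2) K) {u : GL (Fin 1) K}
    (hu2 : Valued.v ((u : Matrix (Fin 1) (Fin 1) K) 0 0 - 1) ≤ Valued.v (ϖ ^ 2)) :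
    {M : Submodule 𝒪[K] (Fin 3 → K) | IsSelfDualLattice σ ϖ (!![H₂ 0 0, 0, H₂ 0 1; 0, h, 0; H₂ 1 0, 0, H₂ 1 1] : Matrix (Fin 3) (Fin 3) K) M ∧
        mapGL (endoGL (γ₂, u)) M = M ∧ (Pi.single 1 1 : Fin 3 → K) ∈ M ∧
        ¬ M.map ((Matrix.toLin' (((endoGL (γ₂, u) : GL (Fin 3) K) : Matrix (Fin 3) (Fin 3) K) - 1)).restrictScalars 𝒪[K]) ≤ scaleLattice ϖ M}.ncard =
      {B : Submodule 𝒪[K] (Fin 2 → K) | IsSelfDualLattice σ ϖ H₂ B ∧ mapGL γ₂ B = B ∧ ¬ B.map ((Matrix.toLin' ((γ₂ : Matrix (Fin 2) (Fin 2) K) - 1)).restrictScalars 𝒪[K]) ≤ scaleLattice ϖ B}.ncard :=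
  ncard_selfDual_fixed_axis_eq σ hvσ hϖ0 hϖ1.le hH₂ hh γ₂ (v_apply_eq_one_of_twoDeep hϖ1 hu2) _ _ fun g₂ => by
    rw [map_endoGL_sub_one_latt_endoGL_le_scaleLattice_iff hϖ0]
    exact not_congr ⟨fun H => H.1, fun H => ⟨H, v_sub_one_le_of_twoDeep hϖ1 hu2⟩⟩

/-- **AXIS SUMMAND, ROW `reg`** (`u` 2-deep): `#{M ∣ SD, ΓM = M, e₁ ∈ M, LEV(ϖ) ∧ ¬LEV(ϖ²) ∧ ¬LEV₂(ϖ³)} = #{B ∣ SD_W, γ₂B = B, LEV(ϖ) ∧ ¬LEV(ϖ²) ∧ ¬LEV₂(ϖ³)}`.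
[cite: BruhatTits1972, §10] [cite: Kottwitz1986, §3] [cite: Rogawski1990, §4.8 Case (a) p. 53] -/
theorem ncard_selfDual_fixed_axis_reg_eq (σ : K →+* K) (hvσ : ∀ a, Valued.v (σ a) = Valued.v a) {ϖ : K} (hϖ0 : ϖ ≠ 0) (hϖ1 : Valued.v ϖ < 1)
    {H₂ : Matrix (Fin 2) (Fin 2) K} (hH₂ : IsUnit H₂.det) {h : K} (hh : Valued.v h = 1) (γ₂ : GL (Fin 2) K) {u : GL (Fin 1) K}
    (hu2 : Valued.v ((u : Matrix (Fin 1) (Fin 1) K) 0 0 - 1) ≤ Valued.v (ϖ ^ 2)) :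
    {M : Submodule 𝒪[K] (Fin 3 → K) | IsSelfDualLattice σ ϖ (!![H₂ 0 0, 0, H₂ 0 1; 0, h, 0; H₂ 1 0, 0, H₂ 1 1] : Matrix (Fin 3) (Fin 3) K) M ∧
        mapGL (endoGL (γ₂, u)) M = M ∧ (Pi.single 1 1 : Fin 3 → K) ∈ M ∧
        (M.map ((Matrix.toLin' (((endoGL (γ₂, u) : GL (Fin 3) K) : Matrix (Fin 3) (Fin 3) K) - 1)).restrictScalars 𝒪[K]) ≤ scaleLattice ϖ M ∧ ¬ M.map ((Matrix.toLin' (((endoGL (γ₂, u) : GL (Fin 3) K) : Matrix (Fin 3) (Fin 3) K) - 1)).restrictScalars 𝒪[K]) ≤ scaleLattice (ϖ ^ 2) M ∧ ¬ M.map ((Matrix.toLin' ((((endoGL (γ₂, u) : GL (Fin 3) K) : Matrix (Fin 3) (Fin 3) K) - 1) ^ 2)).restrictScalars 𝒪[K]) ≤ scaleLattice (ϖ ^ 3) M)}.ncard =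
      {B : Submodule 𝒪[K] (Fin 2 → K) | IsSelfDualLattice σ ϖ H₂ B ∧ mapGL γ₂ B = B ∧ (B.map ((Matrix.toLin' ((γ₂ : Matrix (Fin 2) (Fin 2) K) - 1)).restrictScalars 𝒪[K]) ≤ scaleLattice ϖ B ∧ ¬ B.map ((Matrix.toLin' ((γ₂ : Matrix (Fin 2) (Fin 2) K) - 1)).restrictScalars 𝒪[K]) ≤ scaleLattice (ϖ ^ 2) B ∧ ¬ B.map ((Matrix.toLin' (((γ₂ : Matrix (Fin 2) (Fin 2) K) - 1) ^ 2)).restrictScalars 𝒪[K]) ≤ scaleLattice (ϖ ^ 3) B)}.ncard :=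
  ncard_selfDual_fixed_axis_eq σ hvσ hϖ0 hϖ1.le hH₂ hh γ₂ (v_apply_eq_one_of_twoDeep hϖ1 hu2) _ _ fun g₂ => by
    rw [map_endoGL_sub_one_latt_endoGL_le_scaleLattice_iff hϖ0, map_endoGL_sub_one_latt_endoGL_le_scaleLattice_iff (pow_ne_zero 2 hϖ0),
      map_endoGL_sub_one_sq_latt_endoGL_le_scaleLattice_iff (pow_ne_zero 3 hϖ0)]
    exact ⟨fun H => ⟨H.1.1, fun H' => H.2.1 ⟨H', hu2⟩, fun H' => H.2.2 ⟨H', v_sub_one_sq_le_of_twoDeep hϖ1 hu2⟩⟩,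
      fun H => ⟨⟨H.1, v_sub_one_le_of_twoDeep hϖ1 hu2⟩, fun H' => H.2.1 H'.1, fun H' => H.2.2 H'.1⟩⟩

/-- **AXIS SUMMAND, ROW `1+` (class token present)** (`u` 2-deep, any class constant `c₀`): `#{M ∣ SD, ΓM = M, e₁ ∈ M, LEV(ϖ) ∧ ¬LEV(ϖ²) ∧ LEV₂(ϖ³) ∧ CLS(c₀)} =
#{B ∣ SD_W, γ₂B = B, LEV(ϖ) ∧ ¬LEV(ϖ²) ∧ LEV₂(ϖ³) ∧ CLS(c₀)}`. [cite: BruhatTits1972, §10] [cite: Kottwitz1986, §3] [cite: Rogawski1990, §4.8 Case (a) p. 53] -/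
theorem ncard_selfDual_fixed_axis_rankOne_class_eq (σ : K →+* K) (hvσ : ∀ a, Valued.v (σ a) = Valued.v a) {ϖ : K} (hϖ0 : ϖ ≠ 0) (hϖ1 : Valued.v ϖ < 1)
    {H₂ : Matrix (Fin 2) (Fin 2) K} (hH₂ : IsUnit H₂.det) {h : K} (hh : Valued.v h = 1) (γ₂ : GL (Fin 2) K) {u : GL (Fin 1) K}
    (hu2 : Valued.v ((u : Matrix (Fin 1) (Fin 1) K) 0 0 - 1) ≤ Valued.v (ϖ ^ 2)) (c₀ : K) :
    {M : Submodule 𝒪[K] (Fin 3 → K) | IsSelfDualLattice σ ϖ (!![H₂ 0 0, 0, H₂ 0 1; 0, h, 0; H₂ 1 0, 0, H₂ 1 1] : Matrix (Fin 3) (Fin 3) K) M ∧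
        mapGL (endoGL (γ₂, u)) M = M ∧ (Pi.single 1 1 : Fin 3 → K) ∈ M ∧
        (M.map ((Matrix.toLin' (((endoGL (γ₂, u) : GL (Fin 3) K) : Matrix (Fin 3) (Fin 3) K) - 1)).restrictScalars 𝒪[K]) ≤ scaleLattice ϖ M ∧ ¬ M.map ((Matrix.toLin' (((endoGL (γ₂, u) : GL (Fin 3) K) : Matrix (Fin 3) (Fin 3) K) - 1)).restrictScalars 𝒪[K]) ≤ scaleLattice (ϖ ^ 2) M ∧ M.map ((Matrix.toLin' ((((endoGL (γ₂, u) : GL (Fin 3) K) : Matrix (Fin 3) (Fin 3) K) - 1) ^ 2)).restrictScalars 𝒪[K]) ≤ scaleLattice (ϖ ^ 3) M ∧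
          ∃ y ∈ M, ∃ a : K, Valued.v a = 1 ∧ Valued.v (ϖ⁻¹ * pairing σ (!![H₂ 0 0, 0, H₂ 0 1; 0, h, 0; H₂ 1 0, 0, H₂ 1 1] : Matrix (Fin 3) (Fin 3) K) y ((((endoGL (γ₂, u) : GL (Fin 3) K) : Matrix (Fin 3) (Fin 3) K) - 1) *ᵥ y) - c₀ * a ^ 2) < 1)}.ncard =
      {B : Submodule 𝒪[K] (Fin 2 → K) | IsSelfDualLattice σ ϖ H₂ B ∧ mapGL γ₂ B = B ∧ (B.map ((Matrix.toLin' ((γ₂ : Matrix (Fin 2) (Fin 2) K) - 1)).restrictScalars 𝒪[K]) ≤ scaleLattice ϖ B ∧ ¬ B.map ((Matrix.toLin' ((γ₂ : Matrix (Fin 2) (Fin 2) K) - 1)).restrictScalars 𝒪[K]) ≤ scaleLattice (ϖ ^ 2) B ∧ B.map ((Matrix.toLin' (((γ₂ : Matrix (Fin 2) (Fin 2) K) - 1) ^ 2)).restrictScalars 𝒪[K]) ≤ scaleLattice (ϖ ^ 3) B ∧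
          ∃ y₂ ∈ B, ∃ a : K, Valued.v a = 1 ∧ Valued.v (ϖ⁻¹ * pairing σ H₂ y₂ (((γ₂ : Matrix (Fin 2) (Fin 2) K) - 1) *ᵥ y₂) - c₀ * a ^ 2) < 1)}.ncard :=
  ncard_selfDual_fixed_axis_eq σ hvσ hϖ0 hϖ1.le hH₂ hh γ₂ (v_apply_eq_one_of_twoDeep hϖ1 hu2) _ _ fun g₂ => by
    rw [map_endoGL_sub_one_latt_endoGL_le_scaleLattice_iff hϖ0, map_endoGL_sub_one_latt_endoGL_le_scaleLattice_iff (pow_ne_zero 2 hϖ0),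
      map_endoGL_sub_one_sq_latt_endoGL_le_scaleLattice_iff (pow_ne_zero 3 hϖ0),
      exists_class_latt_endoGL_one_iff σ hvσ H₂ hh.le g₂ γ₂ u (v_inv_mul_sub_one_lt_one_of_twoDeep hϖ0 hϖ1 hu2) c₀]
    exact ⟨fun H => ⟨H.1.1, fun H' => H.2.1 ⟨H', hu2⟩, H.2.2.1.1, H.2.2.2⟩,
      fun H => ⟨⟨H.1, v_sub_one_le_of_twoDeep hϖ1 hu2⟩, fun H' => H.2.1 H'.1, ⟨H.2.2.1, v_sub_one_sq_le_of_twoDeep hϖ1 hu2⟩, H.2.2.2⟩⟩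

/-- **AXIS SUMMAND, ROW `1−` (class token absent)** (`u` 2-deep, any class constant `c₀`): `#{M ∣ SD, ΓM = M, e₁ ∈ M, LEV(ϖ) ∧ ¬LEV(ϖ²) ∧ LEV₂(ϖ³) ∧ ¬CLS(c₀)} =
#{B ∣ SD_W, γ₂B = B, LEV(ϖ) ∧ ¬LEV(ϖ²) ∧ LEV₂(ϖ³) ∧ ¬CLS(c₀)}`. [cite: BruhatTits1972, §10] [cite: Kottwitz1986, §3] [cite: Rogawski1990, §4.8 Case (a) p. 53] -/
theorem ncard_selfDual_fixed_axis_rankOne_not_class_eq (σ : K →+* K) (hvσ : ∀ a, Valued.v (σ a) = Valued.v a) {ϖ : K} (hϖ0 : ϖ ≠ 0) (hϖ1 : Valued.v ϖ < 1)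
    {H₂ : Matrix (Fin 2) (Fin 2) K} (hH₂ : IsUnit H₂.det) {h : K} (hh : Valued.v h = 1) (γ₂ : GL (Fin 2) K) {u : GL (Fin 1) K}
    (hu2 : Valued.v ((u : Matrix (Fin 1) (Fin 1) K) 0 0 - 1) ≤ Valued.v (ϖ ^ 2)) (c₀ : K) :
    {M : Submodule 𝒪[K] (Fin 3 → K) | IsSelfDualLattice σ ϖ (!![H₂ 0 0, 0, H₂ 0 1; 0, h, 0; H₂ 1 0, 0, H₂ 1 1] : Matrix (Fin 3) (Fin 3) K) M ∧
        mapGL (endoGL (γ₂, u)) M = M ∧ (Pi.single 1 1 : Fin 3 → K) ∈ M ∧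
        (M.map ((Matrix.toLin' (((endoGL (γ₂, u) : GL (Fin 3) K) : Matrix (Fin 3) (Fin 3) K) - 1)).restrictScalars 𝒪[K]) ≤ scaleLattice ϖ M ∧ ¬ M.map ((Matrix.toLin' (((endoGL (γ₂, u) : GL (Fin 3) K) : Matrix (Fin 3) (Fin 3) K) - 1)).restrictScalars 𝒪[K]) ≤ scaleLattice (ϖ ^ 2) M ∧ M.map ((Matrix.toLin' ((((endoGL (γ₂, u) : GL (Fin 3) K) : Matrix (Fin 3) (Fin 3) K) - 1) ^ 2)).restrictScalars 𝒪[K]) ≤ scaleLattice (ϖ ^ 3) M ∧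
          ¬ ∃ y ∈ M, ∃ a : K, Valued.v a = 1 ∧ Valued.v (ϖ⁻¹ * pairing σ (!![H₂ 0 0, 0, H₂ 0 1; 0, h, 0; H₂ 1 0, 0, H₂ 1 1] : Matrix (Fin 3) (Fin 3) K) y ((((endoGL (γ₂, u) : GL (Fin 3) K) : Matrix (Fin 3) (Fin 3) K) - 1) *ᵥ y) - c₀ * a ^ 2) < 1)}.ncard =
      {B : Submodule 𝒪[K] (Fin 2 → K) | IsSelfDualLattice σ ϖ H₂ B ∧ mapGL γ₂ B = B ∧ (B.map ((Matrix.toLin' ((γ₂ : Matrix (Fin 2) (Fin 2) K) - 1)).restrictScalars 𝒪[K]) ≤ scaleLattice ϖ B ∧ ¬ B.map ((Matrix.toLin' ((γ₂ : Matrix (Fin 2) (Fin 2) K) - 1)).restrictScalars 𝒪[K]) ≤ scaleLattice (ϖ ^ 2) B ∧ B.map ((Matrix.toLin' (((γ₂ : Matrix (Fin 2) (Fin 2) K) - 1) ^ 2)).restrictScalars 𝒪[K]) ≤ scaleLattice (ϖ ^ 3) B ∧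
          ¬ ∃ y₂ ∈ B, ∃ a : K, Valued.v a = 1 ∧ Valued.v (ϖ⁻¹ * pairing σ H₂ y₂ (((γ₂ : Matrix (Fin 2) (Fin 2) K) - 1) *ᵥ y₂) - c₀ * a ^ 2) < 1)}.ncard :=
  ncard_selfDual_fixed_axis_eq σ hvσ hϖ0 hϖ1.le hH₂ hh γ₂ (v_apply_eq_one_of_twoDeep hϖ1 hu2) _ _ fun g₂ => by
    rw [map_endoGL_sub_one_latt_endoGL_le_scaleLattice_iff hϖ0, map_endoGL_sub_one_latt_endoGL_le_scaleLattice_iff (pow_ne_zero 2 hϖ0),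
      map_endoGL_sub_one_sq_latt_endoGL_le_scaleLattice_iff (pow_ne_zero 3 hϖ0),
      exists_class_latt_endoGL_one_iff σ hvσ H₂ hh.le g₂ γ₂ u (v_inv_mul_sub_one_lt_one_of_twoDeep hϖ0 hϖ1 hu2) c₀]
    exact ⟨fun H => ⟨H.1.1, fun H' => H.2.1 ⟨H', hu2⟩, H.2.2.1.1, H.2.2.2⟩,
      fun H => ⟨⟨H.1, v_sub_one_le_of_twoDeep hϖ1 hu2⟩, fun H' => H.2.1 H'.1, ⟨H.2.2.1, v_sub_one_sq_le_of_twoDeep hϖ1 hu2⟩, H.2.2.2⟩⟩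

end Literature.NumberTheory.Automorphic.UnitaryLatticeTree
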